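/-
Copyright: the b2b-balaban T⁴-continuum CRUX team, row NE7b leaf lineage `t4-ne7b-formalise-leaf-06` (gen 155). Project licence.
-/
import Mathlib.Analysis.SpecialFunctions.Pow.Real
import Mathlib.Tactic.Positivity
import Mathlib.Tactic.Linarith
import Mathlib.Tactic.FieldSimp

/-!
# THE HARD-STEP TOWER's CLOSING CONDITIONS IN ONE DIMENSIONLESS NUMBER: with `s := |t|·K₁` (`K₁ = (N⁻¹ − c)⁻¹` the chart's Lipschitz
# constant, `t` the rescaling), the two-step assembly's side conditions hold with THE SAME `(N, c, r)` at the next scale and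
# NON-GROWING sizes `(B, G, M₃)` as soon as `s < 1`, `s³(1 + 2BK₁) ≤ 1`, `s³(1 + 2BK₁)·M₃r ≤ c` and `(1 + s²B∕m)μ + m⁻¹ ≤ N`
# (row NE7b, node U5c; Mathlib only; [folklore] real arithmetic — the SHAPE of the «closing family», its numbers (A3))

Cell `pub-balaban`, sub-cell `t4`, spine estimate NE7b (`T4WeightBudget.RelWeightBound`; the cell's OWN estimate — NOT PRINTED in
[Bałaban 1983–89], NOT PROVED).  Crux-route work under `Spine/NE7b/` by a row leaf (`t4-ne7b-formalise-leaf-06` gen 155) in the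
hard-step cell under FREEZE (0)'s crux-prover clause; NOTHING of Bałaban's is named as a Lean object, valued or asserted; no
`T4Continuum/Support` leaf typed; no `def`; zero `sorry`.  Imports: Mathlib only.  The consumer `…HardStepTowerTwoSteps` (HSTT, this
lineage: `nextStep_of_letters` ∕ `twoSteps` ∕ `twoSteps_of_twoScale`) is met BY SHAPE: its side conditions `hr₂ρ : r₂ < (N⁻¹ − c)r∕|t|`,
`hc₂r : |t|³·M₃K₁K₁²(1 + 2BK₁)·r₂ ≤ c₂`, `hN₂ : (1 + t²BK₁²∕m₂)‖M₂‖ + m₂⁻¹ ≤ N₂` are concluded here for `(N₂, c₂, r₂) := (N, c, r)`.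

WHY.  HSTT shows the induction RE-ENTERS in shape with next sizes `(B, G, M₃) ↦ (t²BK₁², |t|GK₁, |t|³M₃K₁K₁²(1 + 2BK₁))`, next radius
`r₂ < (N⁻¹ − c)r∕|t|`, next modulus `c₂ ≥ |t|³M₃K₁K₁²(1 + 2BK₁)·r₂`, next equivalence bound from `(1 + t²BK₁²∕m₂)‖M₂‖ + m₂⁻¹ ≤ N₂`.
idea-1's located debt «the closing family `c_k < N_k⁻¹` with non-degrading `(B_k, Λ_k, θ_k, r_k)` under print's rescaling» asks when
these can be met WITHOUT degrading.  In the one dimensionless number `s := |t|K₁` the answer is elementary: every size carries a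
positive power of `s` (times the bounded factor `1 + 2BK₁` for `M₃`), so `s < 1` plus two explicit smallness conditions make the SAME
triple `(N, c, r)` admissible at the next scale with sizes no larger — given the two model letters the step does not produce
(`‖M₂‖ ≤ μ`, next coercivity `m₂ ≥ m`).  The homothety ALONE is a change of units — every dimensionless ratio of the step is
invariant under it, it creates no margin (the pricing desk's remark F627); the margin sits in the model letter `m ≤ m₂′ = t²m₂∕d²`,
i.e. `d² ≤ t²·(m₂∕m)`: the BLOCKING must contract fluctuations (`‖Dv‖ ≤ d‖v‖`, `d ≲ |t|`) by at least the rescaling factor — the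
averaging operator's property, not arithmetic.  Which `s`, `d`, `m₂` print has (`t = L^{−α}`, `K₁` from (A1c)) is (A3); this file is the shape.

WHAT IS PROVED ([folklore]; all letters real numbers, `P := N⁻¹ − c > 0`, `K₁ := P⁻¹`, `s := |t|·K₁`):
* §1 `K_pos`, `s_def_pos` (bookkeeping: `0 < K₁`, `0 < s` for `t ≠ 0`), `radius_admissible` (`s < 1 ⟹ r < P·r∕|t|` for `r > 0` —
  HSTT's `hr₂ρ` with `r₂ := r`).
* §2 THE SIZES DO NOT GROW: `nextB_le` (`0 < P`, `s ≤ 1 ⟹ t²BK₁² ≤ B`, `B ≥ 0`), `nextG_le` (`s ≤ 1 ⟹ |t|GK₁ ≤ G`, `G ≥ 0`), `nextM₃_le`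
  (`s³(1 + 2BK₁) ≤ 1 ⟹ |t|³M₃K₁K₁²(1 + 2BK₁) ≤ M₃`, `M₃ ≥ 0`), and the identity `nextM₃_eq` (`|t|³M₃K₁K₁²(1 + 2BK₁) = s³(1 + 2BK₁)M₃`).
* §3 THE SAME `(c, N)` SERVE: `nextModulus_le` (`s³(1 + 2BK₁)M₃r ≤ c ⟹ |t|³M₃K₁K₁²(1 + 2BK₁)·r ≤ c` — HSTT's `hc₂r` with
  `(c₂, r₂) := (c, r)`), `nextEquivBound_le` (`(1 + s²B∕m)μ + m⁻¹ ≤ N`, `0 < m ≤ m₂`, `0 ≤ ‖M₂‖ ≤ μ`, `B ≥ 0` ⟹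
  `(1 + t²BK₁²∕m₂)‖M₂‖ + m₂⁻¹ ≤ N` — HSTT's `hN₂` with `N₂ := N`).
* §4 THE END `closing_conditions` — the conjunction: under `t ≠ 0`, `0 < P`, `0 < r`, `B, G, M₃ ≥ 0`, `s < 1`, `s³(1 + 2BK₁) ≤ 1`,
  `s³(1 + 2BK₁)M₃r ≤ c`, `(1 + s²B∕m)μ + m⁻¹ ≤ N`, `0 < m ≤ m₂`, `0 ≤ ‖M₂‖ ≤ μ`: HSTT's three side conditions at `(N, c, r)` AND the
  three size inequalities.
* §5 toy: `N⁻¹ − c = 1∕2` (`K₁ = 2`), `t = 1∕8` (`s = 1∕4`), `B = 1`: `s³(1 + 2BK₁) = 5∕64 ≤ 1`.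

NOT HERE (honest): the values of `s`, `μ`, `m`, `m₂`, `d` for print's small-field action and blockings ((A3) ∕ (A1c), NC-NE7b-α
UNRULED) — in particular that the rescaled two-scale coercivity `t²m₂∕d²` dominates `m` (the canonical-dimension bookkeeping of the
`L`-blocking; a MODEL property, not arithmetic); the `n`-step tower; anything of Bałaban's.  BY-NAME EFFECT ON THE WALL: NONE.  NE7b
NOT PRINTED ∕ NOT PROVED; spine PROVED 0∕9; rung (B)+1 on a FINITE torus — NOT infinite volume, NOT the mass gap, NOT Clay.  HONEST
DEPENDENCY: continuum YM on T⁴ ⇐ BetaPertH ∧ nine spine estimates (0∕9 proved); BetaPertH ⇐ (D1) ∧ (D4) ∧ CAP+tail; G-an2-4 gates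
asym, D1 and NE2∕3∕4.
-/

set_option autoImplicit false

namespace Summit.QuantumFields.BalabanUV.T4Continuum.NE7b.HardStepTowerBox

/-! ## §1. Bookkeeping: `K₁ = P⁻¹`, `s = |t|K₁`, the radius -/

/-- `0 < P ⟹ 0 < P⁻¹`. [folklore] -/
theorem K_pos {P : ℝ} (hP : 0 < P) : 0 < P⁻¹ := inv_pos.mpr hP

/-- `t ≠ 0`, `0 < P` ⟹ `0 < |t|·P⁻¹`. [folklore] -/
theorem s_def_pos {P t : ℝ} (hP : 0 < P) (ht : t ≠ 0) : 0 < |t| * P⁻¹ := mul_pos (abs_pos.mpr ht) (inv_pos.mpr hP)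

/-- **THE RADIUS IS ADMISSIBLE UNCHANGED**: `s = |t|P⁻¹ < 1`, `r > 0` ⟹ `r < P·r∕|t|` (HSTT's `hr₂ρ` with `r₂ := r`). [folklore] -/
theorem radius_admissible {P t r : ℝ} (hP : 0 < P) (ht : t ≠ 0) (hr : 0 < r) (hs : |t| * P⁻¹ < 1) : r < P * r / |t| := by
  have ht' : 0 < |t| := abs_pos.mpr ht
  rw [lt_div_iff₀ ht']
  have h1 : |t| < P := by
    have := mul_lt_mul_of_pos_right hs hP
    rwa [mul_assoc, inv_mul_cancel₀ hP.ne', mul_one, one_mul] at this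
  nlinarith

/-! ## §2. The sizes do not grow -/

/-- `0 < P`, `s ≤ 1`, `B ≥ 0` ⟹ `t²·B·K₁² ≤ B` (`t²K₁² = s²`). [folklore] -/
theorem nextB_le {P t B : ℝ} (hP : 0 < P) (hB : 0 ≤ B) (hs : |t| * P⁻¹ ≤ 1) : t ^ 2 * (B * (P⁻¹) ^ 2) ≤ B := by
  have hs0 : 0 ≤ |t| * P⁻¹ := mul_nonneg (abs_nonneg t) (inv_pos.mpr hP).le
  have hs2 : (|t| * P⁻¹) ^ 2 ≤ 1 := by nlinarith
  have e : t ^ 2 * (B * (P⁻¹) ^ 2) = (|t| * P⁻¹) ^ 2 * B := by rw [mul_pow, sq_abs]; ring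
  rw [e]
  nlinarith

/-- `s ≤ 1`, `G ≥ 0` ⟹ `|t|·G·K₁ ≤ G`. [folklore] -/
theorem nextG_le {P t G : ℝ} (hG : 0 ≤ G) (hs : |t| * P⁻¹ ≤ 1) : |t| * (G * P⁻¹) ≤ G := by
  have e : |t| * (G * P⁻¹) = (|t| * P⁻¹) * G := by ring
  rw [e]
  nlinarith

/-- The next Hessian-Lipschitz size in `s`: `|t|³·(M₃K₁K₁²(1 + 2BK₁)) = s³·(1 + 2BK₁)·M₃`. [folklore] -/
theorem nextM₃_eq (P t B M₃ : ℝ) :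
    |t| ^ 3 * (M₃ * P⁻¹ * (P⁻¹) ^ 2 * (1 + 2 * B * P⁻¹)) = (|t| * P⁻¹) ^ 3 * (1 + 2 * B * P⁻¹) * M₃ := by
  ring

/-- `s³(1 + 2BK₁) ≤ 1`, `M₃ ≥ 0` ⟹ the next Hessian-Lipschitz size is `≤ M₃`. [folklore] -/
theorem nextM₃_le {P t B M₃ : ℝ} (hM₃ : 0 ≤ M₃) (hs3 : (|t| * P⁻¹) ^ 3 * (1 + 2 * B * P⁻¹) ≤ 1) :
    |t| ^ 3 * (M₃ * P⁻¹ * (P⁻¹) ^ 2 * (1 + 2 * B * P⁻¹)) ≤ M₃ := by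
  rw [nextM₃_eq]
  nlinarith

/-! ## §3. The same modulus and the same equivalence bound serve -/

/-- **THE SAME MODULUS**: `s³(1 + 2BK₁)·M₃·r ≤ c` ⟹ HSTT's `hc₂r` with `(c₂, r₂) := (c, r)`. [folklore] -/
theorem nextModulus_le {P t B M₃ r c : ℝ} (h : (|t| * P⁻¹) ^ 3 * (1 + 2 * B * P⁻¹) * M₃ * r ≤ c) :
    |t| ^ 3 * (M₃ * P⁻¹ * (P⁻¹) ^ 2 * (1 + 2 * B * P⁻¹)) * r ≤ c := by
  rw [nextM₃_eq]
  exact h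

/-- **THE SAME EQUIVALENCE BOUND**: `(1 + s²B∕m)μ + m⁻¹ ≤ N` with `0 < m ≤ m₂`, `0 ≤ ‖M₂‖ ≤ μ`, `B ≥ 0` ⟹
`(1 + t²BK₁²∕m₂)‖M₂‖ + m₂⁻¹ ≤ N` (HSTT's `hN₂` with `N₂ := N`; monotone in `m₂` and `‖M₂‖`). [folklore] -/
theorem nextEquivBound_le {P t B m m₂ nM μ N : ℝ} (hB : 0 ≤ B) (hm : 0 < m) (hmm : m ≤ m₂) (hnM : 0 ≤ nM) (hnMμ : nM ≤ μ)
    (h : (1 + (|t| * P⁻¹) ^ 2 * B / m) * μ + m⁻¹ ≤ N) :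
    (1 + t ^ 2 * (B * (P⁻¹) ^ 2) / m₂) * nM + m₂⁻¹ ≤ N := by
  have hm₂ : 0 < m₂ := lt_of_lt_of_le hm hmm
  have e : t ^ 2 * (B * (P⁻¹) ^ 2) = (|t| * P⁻¹) ^ 2 * B := by rw [mul_pow, sq_abs]; ring
  rw [e]
  have hx : 0 ≤ (|t| * P⁻¹) ^ 2 * B := mul_nonneg (sq_nonneg _) hB
  have h1 : (|t| * P⁻¹) ^ 2 * B / m₂ ≤ (|t| * P⁻¹) ^ 2 * B / m := div_le_div_of_nonneg_left hx hm hmm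
  have h2 : m₂⁻¹ ≤ m⁻¹ := (inv_le_inv₀ hm₂ hm).mpr hmm
  have h3 : 0 ≤ 1 + (|t| * P⁻¹) ^ 2 * B / m₂ := by positivity
  have h4 : (1 + (|t| * P⁻¹) ^ 2 * B / m₂) * nM ≤ (1 + (|t| * P⁻¹) ^ 2 * B / m) * μ :=
    mul_le_mul (by linarith) hnMμ hnM (by positivity)
  linarith

/-! ## §4. The END: the closing conditions -/

/-- **THE CLOSING CONDITIONS OF THE TWO-STEP ASSEMBLY.**  `t ≠ 0`, `0 < P` (`= N⁻¹ − c`), `0 < r`, `B, G, M₃ ≥ 0`; the dimensionless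
`s := |t|P⁻¹` with `s < 1`, `s³(1 + 2BP⁻¹) ≤ 1`, `s³(1 + 2BP⁻¹)M₃r ≤ c`; the model letters `0 < m ≤ m₂` (next coercivity no smaller),
`0 ≤ ‖M₂‖ ≤ μ`, and `(1 + s²B∕m)μ + m⁻¹ ≤ N` ⟹ HSTT's side conditions with `(N₂, c₂, r₂) := (N, c, r)` — `r < P·r∕|t|`,
`|t|³M₃P⁻¹P⁻²(1 + 2BP⁻¹)·r ≤ c`, `(1 + t²BP⁻²∕m₂)‖M₂‖ + m₂⁻¹ ≤ N` — and the sizes do not grow: `t²BP⁻² ≤ B`, `|t|GP⁻¹ ≤ G`,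
`|t|³M₃P⁻¹P⁻²(1 + 2BP⁻¹) ≤ M₃`. [folklore] -/
theorem closing_conditions {P t r B G M₃ c m m₂ nM μ N : ℝ} (hP : 0 < P) (ht : t ≠ 0) (hr : 0 < r)
    (hB : 0 ≤ B) (hG : 0 ≤ G) (hM₃ : 0 ≤ M₃)
    (hs : |t| * P⁻¹ < 1) (hs3 : (|t| * P⁻¹) ^ 3 * (1 + 2 * B * P⁻¹) ≤ 1)
    (hsc : (|t| * P⁻¹) ^ 3 * (1 + 2 * B * P⁻¹) * M₃ * r ≤ c)
    (hm : 0 < m) (hmm : m ≤ m₂) (hnM : 0 ≤ nM) (hnMμ : nM ≤ μ)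
    (hN : (1 + (|t| * P⁻¹) ^ 2 * B / m) * μ + m⁻¹ ≤ N) :
    r < P * r / |t| ∧
      |t| ^ 3 * (M₃ * P⁻¹ * (P⁻¹) ^ 2 * (1 + 2 * B * P⁻¹)) * r ≤ c ∧
      (1 + t ^ 2 * (B * (P⁻¹) ^ 2) / m₂) * nM + m₂⁻¹ ≤ N ∧
      t ^ 2 * (B * (P⁻¹) ^ 2) ≤ B ∧ |t| * (G * P⁻¹) ≤ G ∧
      |t| ^ 3 * (M₃ * P⁻¹ * (P⁻¹) ^ 2 * (1 + 2 * B * P⁻¹)) ≤ M₃ :=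
  ⟨radius_admissible hP ht hr hs, nextModulus_le hsc, nextEquivBound_le hB hm hmm hnM hnMμ hN, nextB_le hP hB hs.le,
    nextG_le hG hs.le, nextM₃_le hM₃ hs3⟩

/-! ## §5. Toy -/

/-- Toy: `P = 1∕2` (`K₁ = 2`), `t = 1∕8` (`s = 1∕4`), `B = 1`: `s³(1 + 2BK₁) = (1∕64)·5 ≤ 1`. -/
example : (|(1 / 8 : ℝ)| * (1 / 2 : ℝ)⁻¹) ^ 3 * (1 + 2 * (1 : ℝ) * (1 / 2 : ℝ)⁻¹) ≤ 1 := by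
  rw [abs_of_pos (by norm_num : (0 : ℝ) < 1 / 8)]
  norm_num

end Summit.QuantumFields.BalabanUV.T4Continuum.NE7b.HardStepTowerBox
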